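import Mathlib
import HarnessLib
import Literature.Computability.AlgebraicComplexity.AsymptoticSpectrum
import Literature.Computability.AlgebraicComplexity.BorderRankCW
import Literature.Computability.AlgebraicComplexity.MatrixMultiplicationExponent
import Literature.Computability.AlgebraicComplexity.TensorRestrictionRank
import Literature.Computability.AlgebraicComplexity.DegenerationSpectralMonotone
import Summits.MatrixMultiplication.MatrixMultiplication.Theorems.LittleCwSliceDeterminants
import Summits.MatrixMultiplication.MatrixMultiplication.Theses.OutsiderSandwich

/-!
# The coupled block of `cw₂ ⊠ cw₂` is not a degeneration top of `⟨2,2,2⟩`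

Topic `Summits/MatrixMultiplication/MatrixMultiplication/Theorems` (decomp-mm tree, lineage
`OutsiderSandwich`, census hand K11 of NODE-g9; supports the aside item
`OutsiderSandwich.PerfectBeyondLaser`, stmt-MatrixMultiplication-31793).

**The object.** Grade the index set `{0,1,2}²` of `cw₂^{⊠2}` (`kroneckerPow (cwTensor K 2) 2`) by
the number of non-zero coordinates `A(u) ∈ {0,1,2}`. On the support of `cw₂^{⊠2}` one has
`A(u)+A(v)+A(w) = 4`, so this is a TIGHT coarse blocking (the laser design `λ = (1,1)`), with block
pattern = permutations of `(0,2,2)` and of `(1,1,2)` — the support pattern of the big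
Coppersmith–Winograd tensor with part sizes `(4,4,1)`. The blocks of type `(0,2,2)` are matrix
products `≅ ⟨1,1,4⟩`; the block of type `(2,1,1)` is the **coupled block**
`C₂ = ∑_{i,k ∈ {1,2}} z_{ik} ⊗ (y_{0k} ⊗ x_{i0} + y_{i0} ⊗ x_{0k})` (8 terms, format
`4 × 4 × 4`, all three flattening ranks `4`; its `z`-slices are `{diag(W, Wᵀ)}` against `⟨2,2,2⟩`'s
`{diag(W, W)}`), which is literally a zeroing-out of `cw₂^{⊠2}` (`block_eq_kroneckerPow`,
`tensorRestrictsTo_kroneckerPow_block`). This file is definition-free: the block is written as the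
explicit `0/1` lambda `blk` below (docstrings), never as a `def`. IF `C₂ ⊵ ⟨2,2,2⟩` held, the laser method on this
design would pack equal matrix products of side `2^{(1/3+γ)N}`, `γ > 0`, perfectly into `cw₂^{⊠N}`
(item `PerfectBeyondLaser`) and give the single-product rate `2^{1.476} > 2.7154` (beyond print).

**Theorem** (`block_not_algDegeneratesTo_matMul`, `cwTwoSquareCoupledBlockNotMM_holds` = route item
`OutsiderSandwich.CwTwoSquareCoupledBlockNotMM`, stmt-MatrixMultiplication-31902). `⟨2,2,2⟩` is NOT an algebraic
degeneration (`AlgDegeneratesTo`, BCS (15.19): polynomial matrices over `ℂ[ε]` of ANY formats) of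
`C₂`; a fortiori not a restriction (`block_not_restrictsTo_matMul`).

**Invariant (1-genericity in the `x`-direction).** Contract the third index (the `x`-variables) of
a `4 × 4 × 4` tensor against a weight vector `ξ` and take the determinant of the resulting `4 × 4`
matrix in `(z, y)`. For `C₂` this determinant vanishes IDENTICALLY in `ξ` over every commutative
domain: the vector `v(ξ)` with `v_{(0,k)} = ξ_{(1,k)}`, `v_{(1,i)} = -ξ_{(0,i)}` is in the kernel
(`block_slice_mulVec`; informally, the bilinear map `(x, y) ↦ a bᵀ + b' a'ᵀ` computed by `C₂`
kills `(b, b') = (a', -a)`), so `det = 0` by the adjugate identity (`block_slice_det`). For `⟨2,2,2⟩`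
the contraction against the identity weight `ξ = δ` is the identity matrix. A degeneration
`(A(ε) ⊗ B(ε) ⊗ C(ε)) C₂ = ε^h ⟨2,2,2⟩ + O(ε^{h+1})` transports the contraction as a matrix product
`A · S(ξ') · Bᵀ` (`LittleCwSliceDeterminants.contract_eq_mul`, tree), whose determinant is therefore
`0`; on the other hand it equals `ε^{4h} · det(1 + ε Q)`, whose constant coefficient after removing
`ε^{4h}` is `det 1 = 1` — a contradiction in the domain `ℂ[ε]`. (For general `q` the coupled block
`C_q` of `cw_q^{⊗2}` has maximal `x`-slice rank `2q - 1 < 2q` = that of `⟨q,2,q⟩`, so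
`C_q ⋭ ⟨q,2,q⟩` for every `q ≥ 2` by the same closed condition; only `q = 2` is formalised.)

Consequence for the decomp-mm tree: census hand K11 (`C₂ ⊵ ⟨2,2,2⟩`?) is decided NO by theorem;
the `k ≤ 2` laser designs of `cw₂` do not certify `PerfectBeyondLaser` through matrix-product
blocks (their coupled blocks fail `1_X`-genericity), a barrier row — witnesses of
`PerfectBeyondLaser`, if any, are non-monomial AND lie outside the `k ≤ 2` laser designs.

References: degenerations and their order calculus, Bürgisser–Clausen–Shokrollahi (1997),
(15.19)–(15.26); coupling of two levels of the Coppersmith–Winograd construction (the block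
`T^{[112]}` is only VALUED there), Coppersmith–Winograd (1990), §7; `1_A`-genericity and
degenerations of matrix multiplication, Landsberg, *Geometry and Complexity Theory* (2017), §5.1.
No source treating the coupled block of the little tensor `cw₂` was found (searches in the seat
notes: corpus fts+vec and galaxy, 2026-08-30); the argument is elementary and self-contained.
-/

set_option linter.dupNamespace false

namespace Summit.MatrixMultiplication.MatrixMultiplication.Theorems.OutsiderSandwichCoupledBlock

open Polynomial Matrix Finset
open Literature.Computability.AlgebraicComplexity
open Summit.MatrixMultiplication.MatrixMultiplication.Theorems.LittleCwSliceDeterminants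

/-! ## The coupled block `blk`

Throughout, `blk` denotes the explicit lambda
`fun a b c : Fin 2 × Fin 2 => if (c.1 = 0 ∧ b.1 = 0 ∧ a = (c.2, b.2)) ∨ (c.1 = 1 ∧ b.1 = 1 ∧ a = (b.2, c.2)) then 1 else 0`
(the coupled block `C₂`; no `def` is introduced). Index conventions: first index `a = (i,k)` ↔ the
`z`-variable `z_{(i+1)(k+1)}`; second index `b = (σ,j)` ↔ `y_{0(j+1)}` if `σ = 0`, `y_{(j+1)0}` if
`σ = 1`; third index `c = (τ,l)` ↔ `x_{(l+1)0}` if `τ = 0`, `x_{0(l+1)}` if `τ = 1`. Entry `1` exactly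
on the 8 triples `z_{lj} y_{0j} x_{l0}` and `z_{jl} y_{j0} x_{0l}`. -/

/-- `Polynomial.C` of a `0/1` entry is the same `0/1` entry over `K[X]`. [folklore] -/
theorem C_ite_one_zero {K : Type*} [CommSemiring K] (p : Prop) [Decidable p] :
    Polynomial.C (if p then (1 : K) else 0) = if p then (1 : K[X]) else 0 := by
  split_ifs <;> simp

/-! ## `C₂` is a zeroing-out of `cw₂ ⊠ cw₂` -/

/-- **`C₂` is the `(2,1,1)`-block of `cw₂^{⊠2}`**: entrywise, `blk` is `cw₂ ⊠ cw₂` at the index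
embeddings `z : (i,k) ↦ (i+1,k+1)`, `y : (0,j) ↦ (0,j+1), (1,j) ↦ (j+1,0)`,
`x : (0,l) ↦ (l+1,0), (1,l) ↦ (0,l+1)`. [this tree, decomp-mm NODE-g9 §2] -/
theorem block_eq_kroneckerPow {K : Type*} [CommSemiring K] (a b c : Fin 2 × Fin 2) :
    (if (c.1 = 0 ∧ b.1 = 0 ∧ a = (c.2, b.2)) ∨ (c.1 = 1 ∧ b.1 = 1 ∧ a = (b.2, c.2)) then (1 : K) else 0) =
      kroneckerPow (cwTensor K 2) 2 ![a.1.succ, a.2.succ]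
        (if b.1 = 0 then ![0, b.2.succ] else ![b.2.succ, 0])
        (if c.1 = 0 then ![c.2.succ, 0] else ![0, c.2.succ]) := by
  obtain ⟨i, k⟩ := a
  obtain ⟨σ, j⟩ := b
  obtain ⟨τ, l⟩ := c
  fin_cases i <;> fin_cases k <;> fin_cases σ <;> fin_cases j <;> fin_cases τ <;> fin_cases l <;>
    simp [kroneckerPow, cwTensor, Fin.prod_univ_two]

/-- **`cw₂ ⊠ cw₂ ≥ C₂`** (zeroing out to the block). [this tree, decomp-mm NODE-g9 §2] -/
theorem tensorRestrictsTo_kroneckerPow_block {K : Type*} [CommSemiring K] :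
    TensorRestrictsTo (kroneckerPow (cwTensor K 2) 2)
      (fun a b c : Fin 2 × Fin 2 => if (c.1 = 0 ∧ b.1 = 0 ∧ a = (c.2, b.2)) ∨ (c.1 = 1 ∧ b.1 = 1 ∧ a = (b.2, c.2)) then (1 : K) else 0) := by
  have e : (fun a b c : Fin 2 × Fin 2 => if (c.1 = 0 ∧ b.1 = 0 ∧ a = (c.2, b.2)) ∨ (c.1 = 1 ∧ b.1 = 1 ∧ a = (b.2, c.2)) then (1 : K) else 0) =
      fun a b c : Fin 2 × Fin 2 => kroneckerPow (cwTensor K 2) 2 ![a.1.succ, a.2.succ]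
        (if b.1 = 0 then ![0, b.2.succ] else ![b.2.succ, 0])
        (if c.1 = 0 then ![c.2.succ, 0] else ![0, c.2.succ]) := by
    funext a b c; exact block_eq_kroneckerPow a b c
  rw [e]
  exact tensorRestrictsTo_precomp _ _ _ _

/-! ## The invariant: every `x`-contraction of `C₂` is singular -/

section Invariant

variable {L : Type*} [CommRing L]

/-- `S(ξ) · v(ξ) = 0` for the `x`-contraction `S(ξ)_{ab} = ∑_c ξ_c (C₂)_{abc}` and the kernel vector
`v_{(0,k)} = ξ_{(1,k)}`, `v_{(1,i)} = -ξ_{(0,i)}`. [this tree] -/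
theorem block_slice_mulVec (ξ : Fin 2 × Fin 2 → L) :
    (Matrix.of fun a b : Fin 2 × Fin 2 => ∑ c, ξ c * (if (c.1 = 0 ∧ b.1 = 0 ∧ a = (c.2, b.2)) ∨ (c.1 = 1 ∧ b.1 = 1 ∧ a = (b.2, c.2)) then (1 : L) else 0)).mulVec
      (fun b => if b.1 = 0 then ξ (1, b.2) else -ξ (0, b.2)) = 0 := by
  funext a
  obtain ⟨i, k⟩ := a
  simp only [Matrix.mulVec, dotProduct, Matrix.of_apply, Fintype.sum_prod_type, Fin.sum_univ_two,
    Pi.zero_apply]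
  fin_cases i <;> fin_cases k <;> simp <;> ring

/-- **Every `x`-contraction of `C₂` is singular** (over a commutative domain): `det S(ξ) = 0`.
[this tree] -/
theorem block_slice_det [IsDomain L] (ξ : Fin 2 × Fin 2 → L) :
    (Matrix.of fun a b : Fin 2 × Fin 2 => ∑ c, ξ c * (if (c.1 = 0 ∧ b.1 = 0 ∧ a = (c.2, b.2)) ∨ (c.1 = 1 ∧ b.1 = 1 ∧ a = (b.2, c.2)) then (1 : L) else 0)).det = 0 := by
  set S : Matrix (Fin 2 × Fin 2) (Fin 2 × Fin 2) L :=
    Matrix.of fun a b : Fin 2 × Fin 2 => ∑ c, ξ c * (if (c.1 = 0 ∧ b.1 = 0 ∧ a = (c.2, b.2)) ∨ (c.1 = 1 ∧ b.1 = 1 ∧ a = (b.2, c.2)) then (1 : L) else 0) with hS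
  set v : Fin 2 × Fin 2 → L := fun b => if b.1 = 0 then ξ (1, b.2) else -ξ (0, b.2) with hv
  by_cases hξ : ξ = 0
  · have h0 : S = 0 := by
      refine Matrix.ext fun a b => ?_
      simp [hS, hξ]
    rw [h0]
    exact Matrix.det_zero
  · obtain ⟨c, hc⟩ : ∃ c, ξ c ≠ 0 := by
      by_contra h'
      push Not at h'
      exact hξ (funext h')
    have hSv : S.mulVec v = 0 := block_slice_mulVec ξ
    have h1 : S.det • v = 0 := by
      have := congrArg (S.adjugate.mulVec) hSv
      rwa [Matrix.mulVec_mulVec, Matrix.adjugate_mul, Matrix.smul_mulVec, Matrix.one_mulVec,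
        Matrix.mulVec_zero] at this
    obtain ⟨τ, l⟩ := c
    have hb : ∃ b, v b ≠ 0 := by
      fin_cases τ
      · exact ⟨(1, l), by simpa [hv] using hc⟩
      · exact ⟨(0, l), by simpa [hv] using hc⟩
    obtain ⟨b, hb⟩ := hb
    have h2 : S.det * v b = 0 := by
      have := congrFun h1 b
      simpa using this
    exact (mul_eq_zero.1 h2).resolve_right hb

end Invariant

/-! ## Main theorem -/

/-- **The coupled block of `cw₂ ⊠ cw₂` does not degenerate to `⟨2,2,2⟩`**: there are no polynomial
matrices `A(ε), B(ε), C(ε)` and `h` with `(A(ε) ⊗ B(ε) ⊗ C(ε)) C₂ = ε^h ⟨2,2,2⟩ + O(ε^{h+1})`.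
Decides census hand K11 (decomp-mm NODE-g9) in the negative. [this tree] -/
theorem block_not_algDegeneratesTo_matMul :
    ¬ AlgDegeneratesTo (fun a b c : Fin 2 × Fin 2 => if (c.1 = 0 ∧ b.1 = 0 ∧ a = (c.2, b.2)) ∨ (c.1 = 1 ∧ b.1 = 1 ∧ a = (b.2, c.2)) then (1 : ℂ) else 0)
      (matMulTensor ℂ 2 2 2) := by
  classical
  rintro ⟨h, A, B, C, hd⟩
  -- the entry polynomials of the transformed tensor
  set P : (Fin 2 × Fin 2) → (Fin 2 × Fin 2) → (Fin 2 × Fin 2) → ℂ[X] := fun a' b' c' =>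
    ∑ a, ∑ b, ∑ c, A a' a * B b' b * C c' c *
      Polynomial.C (if (c.1 = 0 ∧ b.1 = 0 ∧ a = (c.2, b.2)) ∨ (c.1 = 1 ∧ b.1 = 1 ∧ a = (b.2, c.2)) then (1 : ℂ) else 0) with hP
  have hd' : ∀ a' b' c', ∀ j ≤ h, (P a' b' c').coeff j =
      if j = h then matMulTensor ℂ 2 2 2 a' b' c' else 0 := fun a' b' c' j hj => hd a' b' c' j hj
  -- identity weight on the third target index (the variable `Y_{μν}` of `⟨2,2,2⟩`, `μ = ν`)
  set w : Fin 2 × Fin 2 → ℂ[X] := fun c' => if c'.1 = c'.2 then 1 else 0 with hw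
  -- the contracted matrix
  set N : Matrix (Fin 2 × Fin 2) (Fin 2 × Fin 2) ℂ[X] :=
    Matrix.of fun a' b' => ∑ c', w c' * P a' b' c' with hN
  -- (1) `det N = 0`: `N = A · S(ξ) · Bᵀ` with `S(ξ)` singular
  have hdetN : N.det = 0 := by
    have hPX : ∀ a' b' c', P a' b' c' = ∑ a, ∑ b, ∑ c, A a' a * B b' b * C c' c *
        (if (c.1 = 0 ∧ b.1 = 0 ∧ a = (c.2, b.2)) ∨ (c.1 = 1 ∧ b.1 = 1 ∧ a = (b.2, c.2)) then (1 : ℂ[X]) else 0) := by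
      intro a' b' c'
      simp only [hP, C_ite_one_zero]
    have hN' : N = Matrix.of fun a' b' => ∑ c', w c' * ∑ a, ∑ b, ∑ c, A a' a * B b' b * C c' c *
        (if (c.1 = 0 ∧ b.1 = 0 ∧ a = (c.2, b.2)) ∨ (c.1 = 1 ∧ b.1 = 1 ∧ a = (b.2, c.2)) then (1 : ℂ[X]) else 0) := by
      refine Matrix.ext fun a' b' => ?_
      simp only [hN, Matrix.of_apply, hPX]
    have hfac := contract_eq_mul (Equiv.refl (Fin 2 × Fin 2)) A B w C
      (fun a b c : Fin 2 × Fin 2 => if (c.1 = 0 ∧ b.1 = 0 ∧ a = (c.2, b.2)) ∨ (c.1 = 1 ∧ b.1 = 1 ∧ a = (b.2, c.2)) then (1 : ℂ[X]) else 0)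
    have hS0 : (Matrix.of fun a b : Fin 2 × Fin 2 => ∑ c, (∑ c', w c' * C c' c) *
        (if (c.1 = 0 ∧ b.1 = 0 ∧ a = (c.2, b.2)) ∨ (c.1 = 1 ∧ b.1 = 1 ∧ a = (b.2, c.2)) then (1 : ℂ[X]) else 0)).det = 0 :=
      block_slice_det (fun c => ∑ c', w c' * C c' c)
    rw [hN', hfac, Matrix.det_mul, Matrix.det_mul]
    simp only [Equiv.coe_refl, Matrix.submatrix_id_id]
    rw [hS0, mul_zero, zero_mul]
  -- (2) `N = X^h • N₁` with `N₁(0) = 1`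
  have hdiv : ∀ a' b' c', ∃ R : ℂ[X], P a' b' c' = X ^ h * R ∧
      R.coeff 0 = matMulTensor ℂ 2 2 2 a' b' c' := by
    intro a' b' c'
    have hdvd : (X : ℂ[X]) ^ h ∣ P a' b' c' := by
      rw [Polynomial.X_pow_dvd_iff]
      intro d hdh
      have := hd' a' b' c' d hdh.le
      rw [if_neg (Nat.ne_of_lt hdh)] at this
      exact this
    obtain ⟨R, hR⟩ := hdvd
    refine ⟨R, hR, ?_⟩
    have hh := hd' a' b' c' h le_rfl
    rw [if_pos rfl, hR] at hh
    have e : (X ^ h * R : ℂ[X]).coeff h = R.coeff 0 := by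
      have := Polynomial.coeff_X_pow_mul R h 0
      rwa [zero_add] at this
    rw [← e, hh]
  choose R hR hR0 using hdiv
  set N₁ : Matrix (Fin 2 × Fin 2) (Fin 2 × Fin 2) ℂ[X] :=
    Matrix.of fun a' b' => ∑ c', w c' * R a' b' c' with hN₁
  have hNN₁ : N = ((X : ℂ[X]) ^ h) • N₁ := by
    refine Matrix.ext fun a' b' => ?_
    rw [Matrix.smul_apply, smul_eq_mul]
    simp only [hN, hN₁, Matrix.of_apply]
    rw [Finset.mul_sum]
    exact Finset.sum_congr rfl fun c' _ => by rw [hR]; ring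
  -- the constant term of `N₁` is the identity matrix
  have hN₁0 : N₁.map (Polynomial.evalRingHom (0 : ℂ)) = 1 := by
    ext a' b'
    have e1 : (N₁.map (Polynomial.evalRingHom (0 : ℂ))) a' b' =
        ∑ c', (w c').eval 0 * (R a' b' c').coeff 0 := by
      simp only [Matrix.map_apply, hN₁, Matrix.of_apply, Polynomial.coe_evalRingHom,
        Polynomial.eval_finsetSum, Polynomial.eval_mul, Polynomial.coeff_zero_eq_eval_zero]
    rw [e1]
    simp only [hR0, hw]
    obtain ⟨κ, ν⟩ := a'
    obtain ⟨κ', μ⟩ := b'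
    fin_cases κ <;> fin_cases ν <;> fin_cases κ' <;> fin_cases μ <;>
      simp [Fintype.sum_prod_type, Fin.sum_univ_two, matMulTensor]
  have hdetN₁ : N₁.det ≠ 0 := by
    intro h0
    have := RingHom.map_det (Polynomial.evalRingHom (0 : ℂ)) N₁
    rw [h0, map_zero, RingHom.mapMatrix_apply, hN₁0, Matrix.det_one] at this
    exact zero_ne_one this
  -- (3) contradiction: `0 = det N = X^{4h} · det N₁ ≠ 0`
  have hdetN' : N.det = ((X : ℂ[X]) ^ h) ^ Fintype.card (Fin 2 × Fin 2) * N₁.det := by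
    rw [hNN₁, Matrix.det_smul]
  rw [hdetN] at hdetN'
  have hXne : ((X : ℂ[X]) ^ h) ^ Fintype.card (Fin 2 × Fin 2) ≠ 0 :=
    pow_ne_zero _ (pow_ne_zero _ Polynomial.X_ne_zero)
  exact (mul_ne_zero hXne hdetN₁) hdetN'.symm

/-- **Nor is `⟨2,2,2⟩` a restriction of the coupled block.** [this tree] -/
theorem block_not_restrictsTo_matMul :
    ¬ TensorRestrictsTo (fun a b c : Fin 2 × Fin 2 => if (c.1 = 0 ∧ b.1 = 0 ∧ a = (c.2, b.2)) ∨ (c.1 = 1 ∧ b.1 = 1 ∧ a = (b.2, c.2)) then (1 : ℂ) else 0)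
      (matMulTensor ℂ 2 2 2) :=
  fun h => block_not_algDegeneratesTo_matMul h.algDegeneratesTo

/-! ## The route item, by name (rev 9) -/

/-- **Item `OutsiderSandwich.CwTwoSquareCoupledBlockNotMM` (stmt-MatrixMultiplication-31902) holds**:
the `(2,1,1)`-block of `cw₂ ⊠ cw₂`, written as the literal zeroing-out in the item, does not
degenerate to `⟨2,2,2⟩`. [this tree] -/
theorem cwTwoSquareCoupledBlockNotMM_holds :
    Summit.MatrixMultiplication.MatrixMultiplication.Theses.OutsiderSandwich.CwTwoSquareCoupledBlockNotMM := by
  have e : (fun a b c : Fin 2 × Fin 2 => kroneckerPow (cwTensor ℂ 2) 2 ![a.1.succ, a.2.succ]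
      (if b.1 = 0 then ![0, b.2.succ] else ![b.2.succ, 0])
      (if c.1 = 0 then ![c.2.succ, 0] else ![0, c.2.succ])) =
      fun a b c : Fin 2 × Fin 2 => if (c.1 = 0 ∧ b.1 = 0 ∧ a = (c.2, b.2)) ∨ (c.1 = 1 ∧ b.1 = 1 ∧ a = (b.2, c.2)) then (1 : ℂ) else 0 := by
    funext a b c
    exact (block_eq_kroneckerPow a b c).symm
  unfold Summit.MatrixMultiplication.MatrixMultiplication.Theses.OutsiderSandwich.CwTwoSquareCoupledBlockNotMM
  rw [e]
  exact block_not_algDegeneratesTo_matMul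

end Summit.MatrixMultiplication.MatrixMultiplication.Theorems.OutsiderSandwichCoupledBlock
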